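import Summits.AtomisticToContinuum.BoseEinsteinCondensation.Theorems.BoxLatticeFSumCarving
import HarnessLib

/-!
# `BoxLatticeFSum` kernels for the mode-counting piece MC (decomp-a2c · hand-1 g9)

Two census-free kernels named in the plan of the support piece MC = `BoxShellModeCounting` of the
`BoxLatticeFSum` carving (lens-6 g29 node, tree `…Theorems.BoxLatticeFSumCarving`):

* `sum_subMode_eq_indicator`, `boxBlockWave_eq_constantMode_of_coords_zero` — the DCT block wave with
  all indices zero IS the flat mode: `g_0 = L^{-3/2} 1_{[0,L)³} = constantMode L` (pointwise, every
  `K > 0`, `L > 0`): `dctCoeff K 0 B = K^{-3/2}` for every block and the sub-cell modes of side `L/K`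
  tile the cell;
* `exists_even_inWindow` — an even block number `K > 0` with `L/K` in the GP window
  `[A/√ρ, 2A/√ρ]` exists as soon as `L√ρ ≥ 2A` (`K := 2⌈L√ρ/(4A)⌉`).

No definitions, no `sorry`. [folklore]
-/

noncomputable section

open MeasureTheory Set Finset
open scoped ENNReal NNReal BigOperators

namespace Summit.AtomisticToContinuum.BoseEinsteinCondensation.Theorems.BoxLatticeFSum

open Literature.MathematicalPhysics.QuantumManyBody.BoseGas

/-! ## The zero DCT block wave is the flat mode -/

/-- The DCT-II coefficient of the zero wave is `K^{-3/2}` at every block: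
`dctCoeff K q B = (√(1/K))³` when all coordinates of `q` vanish. [folklore] -/
theorem dctCoeff_of_coords_zero {K : ℕ} {q : SubIdx K} (hq : ∀ j : Fin 3, (q j : ℕ) = 0) (B : SubIdx K) :
    dctCoeff K q B = (Real.sqrt (1 / (K : ℝ))) ^ 3 := by
  unfold dctCoeff
  have h : ∀ j : Fin 3, Real.sqrt ((if ((q j : ℕ) = 0) then (1 : ℝ) else 2) / (K : ℝ)) *
      Real.cos (Real.pi * ((q j : ℕ) : ℝ) * ((((B j : Fin K) : ℕ) : ℝ) + 1 / 2) / (K : ℝ)) =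
      Real.sqrt (1 / (K : ℝ)) := by
    intro j
    rw [if_pos (hq j), hq j]
    simp
  rw [Finset.prod_congr rfl fun j _ => h j, Finset.prod_const, Finset.card_univ, Fintype.card_fin]

/-- The sub-cell modes of side `ℓ` sum to the flat profile of the big cell:
`Σ_B subMode ℓ B x = 1_{[0,kℓ)³}(x) · ℓ^{-3/2}` (the `ℂ`-valued twin of the tree's
`sum_indicator_subCell`). [folklore] -/
theorem sum_subMode_eq_indicator {k : ℕ} {ℓ : ℝ} (hℓ : 0 < ℓ) (x : Space) :
    ∑ B : SubIdx k, subMode ℓ B x =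
      (cell (k * ℓ)).indicator (fun _ => ((Real.sqrt (ℓ ^ 3))⁻¹ : ℂ)) x := by
  classical
  simp_rw [subMode_eq_indicator]
  by_cases hx : x ∈ cell (k * ℓ)
  · obtain ⟨q₀, hq₀⟩ := exists_mem_subCell hℓ hx
    rw [Set.indicator_of_mem hx, Finset.sum_eq_single q₀
      (fun q _ hq => Set.indicator_of_notMem (not_mem_subCell_of_ne hℓ (Ne.symm hq) hq₀) _)
      (fun h => absurd (Finset.mem_univ _) h), Set.indicator_of_mem hq₀]
  · rw [Set.indicator_of_notMem hx]
    refine Finset.sum_eq_zero fun q _ => Set.indicator_of_notMem (fun h => hx ?_) _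
    exact subCell_subset_cell hℓ q h

/-- The normalisation constants match: `(√(1/K))³ · (√((L/K)³))⁻¹ = (√(L³))⁻¹`. [folklore] -/
theorem sqrt_inv_cube_mul {K : ℕ} {L : ℝ} (hK : 0 < K) (hL : 0 < L) :
    (Real.sqrt (1 / (K : ℝ))) ^ 3 * (Real.sqrt ((L / (K : ℝ)) ^ 3))⁻¹ = (Real.sqrt (L ^ 3))⁻¹ := by
  have hKr : (0 : ℝ) < K := by exact_mod_cast hK
  have hLK : 0 < L / (K : ℝ) := div_pos hL hKr
  have ha : 0 ≤ (Real.sqrt (1 / (K : ℝ))) ^ 3 * (Real.sqrt ((L / (K : ℝ)) ^ 3))⁻¹ := by positivity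
  have hb : 0 ≤ (Real.sqrt (L ^ 3))⁻¹ := by positivity
  refine (pow_left_inj₀ ha hb two_ne_zero).1 ?_
  rw [mul_pow, inv_pow, inv_pow, Real.sq_sqrt (by positivity), Real.sq_sqrt (by positivity),
    show ((Real.sqrt (1 / (K : ℝ))) ^ 3) ^ 2 = ((Real.sqrt (1 / (K : ℝ))) ^ 2) ^ 3 by ring,
    Real.sq_sqrt (by positivity)]
  field_simp

/-- **`g_0 = constantMode L`**: the DCT block wave whose indices all vanish is the flat mode of the box,
pointwise (every `K > 0`, `L > 0`). [folklore] -/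
theorem boxBlockWave_eq_constantMode_of_coords_zero {K : ℕ} {L : ℝ} (hK : 0 < K) (hL : 0 < L)
    {q : SubIdx K} (hq : ∀ j : Fin 3, (q j : ℕ) = 0) :
    boxBlockWave L K q = constantMode L := by
  have hKr : (0 : ℝ) < K := by exact_mod_cast hK
  have hLK : 0 < L / (K : ℝ) := div_pos hL hKr
  funext x
  unfold boxBlockWave constantMode
  simp_rw [dctCoeff_of_coords_zero hq]
  rw [← Finset.mul_sum, sum_subMode_eq_indicator hLK, mul_div_cancel₀ L hKr.ne']
  by_cases hx : x ∈ cell L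
  · rw [Set.indicator_of_mem hx, Set.indicator_of_mem hx]
    have h := sqrt_inv_cube_mul hK hL
    have h' : (((Real.sqrt (1 / (K : ℝ))) ^ 3 : ℝ) : ℂ) * (((Real.sqrt ((L / (K : ℝ)) ^ 3))⁻¹ : ℝ) : ℂ) =
        (((Real.sqrt (L ^ 3))⁻¹ : ℝ) : ℂ) := by
      rw [← Complex.ofReal_mul, h]
    push_cast at h' ⊢
    exact h'
  · rw [Set.indicator_of_notMem hx, Set.indicator_of_notMem hx, mul_zero]

/-! ## An even block number in the window -/

/-- **An even `K` in the GP window**: if `2A ≤ L√ρ` then some even `K > 0` has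
`A/√ρ ≤ L/K ≤ 2A/√ρ` (`K := 2⌈L√ρ/(4A)⌉`). [folklore] -/
theorem exists_even_inWindow {A ρ L : ℝ} (hA : 0 < A) (hρ : 0 < ρ) (hL : 2 * A ≤ L * Real.sqrt ρ) :
    ∃ K : ℕ, Even K ∧ 0 < K ∧ InWindow A ρ L K := by
  have hsr : 0 < Real.sqrt ρ := Real.sqrt_pos.2 hρ
  obtain ⟨X, hX_def⟩ : ∃ X : ℝ, X = L * Real.sqrt ρ / A := ⟨_, rfl⟩
  have hX2 : 2 ≤ X := by rw [hX_def, le_div_iff₀ hA]; linarith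
  have hX0 : 0 < X := by linarith
  have hLpos : 0 < L := by
    by_contra h
    push Not at h
    have : L * Real.sqrt ρ ≤ 0 := mul_nonpos_of_nonpos_of_nonneg h hsr.le
    linarith
  obtain ⟨m, hm_def⟩ : ∃ m : ℕ, m = ⌈X / 4⌉₊ := ⟨_, rfl⟩
  have hm1 : X / 4 ≤ (m : ℝ) := by rw [hm_def]; exact Nat.le_ceil _
  have hm2 : (m : ℝ) < X / 4 + 1 := by rw [hm_def]; exact Nat.ceil_lt_add_one (by positivity)
  have hmpos : 0 < m := by rw [hm_def]; exact Nat.ceil_pos.2 (by positivity)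
  -- `K = 2m` satisfies `X/2 ≤ K ≤ X`
  have hKle : 2 * (m : ℝ) ≤ X := by
    rcases le_or_gt 4 X with h4 | h4
    · linarith
    · -- `2 ≤ X < 4`: the ceiling is `1`
      have hm_eq : m = 1 := by
        rw [hm_def]
        refine le_antisymm ?_ (Nat.one_le_iff_ne_zero.2 (Nat.pos_iff_ne_zero.1 (by rw [← hm_def]; exact hmpos)))
        exact Nat.ceil_le.2 (by push_cast; linarith)
      rw [hm_eq]; push_cast; linarith
  have hKge : X / 2 ≤ 2 * (m : ℝ) := by linarith
  refine ⟨2 * m, even_two_mul m, by omega, ?_, ?_⟩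
  · -- lower window bound `A/√ρ ≤ L/K` ⟸ `K ≤ X`
    have hKr : (0 : ℝ) < ((2 * m : ℕ) : ℝ) := by exact_mod_cast (show 0 < 2 * m by omega)
    rw [div_le_div_iff₀ hsr hKr]
    have h1 : A * ((2 * m : ℕ) : ℝ) ≤ A * X := by
      push_cast; exact mul_le_mul_of_nonneg_left hKle hA.le
    have h2 : A * X = L * Real.sqrt ρ := by rw [hX_def]; field_simp
    linarith
  · -- upper window bound `L/K ≤ 2A/√ρ` ⟸ `X/2 ≤ K`
    have hKr : (0 : ℝ) < ((2 * m : ℕ) : ℝ) := by exact_mod_cast (show 0 < 2 * m by omega)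
    rw [div_le_div_iff₀ hKr hsr]
    have h1 : A * X ≤ 2 * A * ((2 * m : ℕ) : ℝ) := by
      push_cast; nlinarith [hKge, hA]
    have h2 : A * X = L * Real.sqrt ρ := by rw [hX_def]; field_simp
    linarith

end Summit.AtomisticToContinuum.BoseEinsteinCondensation.Theorems.BoxLatticeFSum

end
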